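import Summits.QuantumFields.YangMills.Theorems.FluctuationComparisonRegPrIntLOddsLedgerPregTop
import HarnessLib

/-!
# THE TOP INCREMENT OF THE ODDS LEDGER VANISHES ON THE WINDOW — LEV's row `stub_levelOddsLedgerCan` (LINE g20-2 `Lines/odds_ledger.lean` v1.2, organ LFR♯ᶜ of the
# deciding crux `FluctuationComparisonRegPrIntL`, stmt-QuantumFields-20520) is FREE at the depth `M = K − J` (budget `w J 0 := 0`)

Cell `ym3-torus` (HUMAN RULING D-0037: YM₃ on T³ = YM-ladder rung R3 — NOT `d = 4`, NOT infinite volume, NOT a mass gap, NOT Clay).  Width seat `ym3-torus-px21`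
gen 12; `--supports stmt-QuantumFields-20520 --as helper` (count-neutral); THEOREMS ONLY (def-free, default heartbeats).

THE POINT.  The line's per-scale increment is `ℓ_M(U) := log q_M(U) − log q_{M+1}(U)` with `q_M := heightDensityCan^{histGoodBelow M}` (the canonical height-`J`
density of the run-`K` Gibbs weight restricted to «the averaged fields at the depths `j < M` are `θ(K−j)`-small»), and LEV asks for a pinned budget
`|Δ² ℓ_M| ≤ w_J(K − J − M)·e^{−κ·tdist(b,b′)}` on window quadruples for every `M ≤ K − J`.  At the TOP depth `M = K − J` the two events are `histGood K (J+1)` and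
`histGood K J` (✓`…PregTop.setOf_depthBelow_eq_histGood`), whose canonical densities AGREE AT EVERY WINDOW POINT below WREG's threshold
(✓`…PregTop.heightDensityCan_succ_eq_on_window`, fed by ✓`…Wreg.windowRegularity`): so `ℓ_{K−J} ≡ 0` on the window and its mixed second difference is `0`
— LEV's `r = 0` budget is `w J 0 := 0` by kernel, and the organ's content sits exactly at the depths `M ≤ K − J − 1` (the depths with at least one
cutoff-free renormalisation transport above the last constrained scale; cf. the PREG DOOR's residual row at the same depths).
* `oddsInc_top_eq_zero_on_window` — `log q_{K−J}(U) − log q_{K−J+1}(U) = 0` for `PlaqSmall θ_J U`, `γ ≤ γ₁^{WREG}`;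
* `abs_fourPt_le_of_eqOn_zero` — a function vanishing on a set has vanishing mixed second differences there (generic, two lines);
* `abs_fourPt_oddsInc_top_le` — hence `|Δ² ℓ_{K−J}| ≤ w · exp(−κ·tdist)` for every `w ≥ 0` (LEV's displayed shape at `M = K − J`, any rate `κ`);
* §2 ★★ `levelOddsLedger_of_below` — the DOOR «LEV ⟸ LEV with the depth guard strengthened to `M + J < K`» (registered text written out on both sides).
All statements are in the line's vocabulary with `histGoodBelow`, `oddsInc`, `fourPt` WRITTEN OUT (δ-equal to the line's `def`s) and `heightDensityCan` :=
✓`…WregGlue.heightDensityCan`.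

HONEST SCOPE.  Bookkeeping over landed theorems; NO estimate of Bałaban's is asserted or proved; LEV at the depths `M ≤ K − J − 1` (its whole content: tail ×
entropy × mixing, [Balaban1985UV3] (38)–(47)), PREG (as lettered), PWREG, LFR♯ᶜ, S2β, the crux `FluctuationComparisonRegPrIntL` (stmt-QuantumFields-20520),
`YM3TorusSU2` and every summit statement are NOT proved here; rung R3 (YM₃ on T³) is NOT d = 4, NOT infinite volume, NOT a mass gap, NOT Clay; the
Yang–Mills mass gap is NOT proved.

References: [Balaban1985UV3] CMP 102 (1985) (7) p.257, (38)–(41) p.266; [Balaban1987RG1] CMP 109 (1987) (0.13) p.254, (2.10) p.267.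
-/

set_option autoImplicit false
noncomputable section

open MeasureTheory Filter Topology Set
open scoped ENNReal NNReal
open Literature.MathematicalPhysics.QuantumFieldTheory.Balaban1983to89
open Literature.MathematicalPhysics.QuantumFieldTheory.Balaban1983to89.T3ContinuumYM3Torus
open Literature.MathematicalPhysics.QuantumFieldTheory.Balaban1983to89.T3NestedUnitLaws
open Literature.MathematicalPhysics.QuantumFieldTheory.Balaban1983to89.T3UnitLawDensityEML
open Literature.MathematicalPhysics.QuantumFieldTheory.Balaban1983to89.T3UnitScaleTilt
open Literature.MathematicalPhysics.QuantumFieldTheory.Balaban1983to89.T3TiltDescent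
open Literature.MathematicalPhysics.QuantumFieldTheory.Balaban1983to89.T3LevelShift
open Literature.MathematicalPhysics.QuantumFieldTheory.Balaban1983to89.T3Thresholds
open Literature.MathematicalPhysics.QuantumFieldTheory.Balaban1983to89.Missing
open Literature.MathematicalPhysics.QuantumFieldTheory.Balaban1983to89.T4Continuum
open scoped Literature.MathematicalPhysics.QuantumFieldTheory.Balaban1983to89.T3OrbitAverage

namespace Summit.QuantumFields.YangMills.Theorems.FluctuationComparisonRegPrIntLOddsLedgerTopIncrement

open Summit.QuantumFields.YangMills.Theorems.FluctuationComparisonRegPrIntLWregGlue (heightDensityCan)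
open Summit.QuantumFields.YangMills.Theorems.FluctuationComparisonRegPrIntLWreg (windowRegularity)
open Summit.QuantumFields.YangMills.Theorems.FluctuationComparisonRegPrIntLOddsLedgerPregTop
  (setOf_depthBelow_eq_histGood setOf_depthBelow_eq_histGood_of_lt heightDensityCan_succ_eq_on_window)

variable (F : T3Family)

/-- **AT FIXED DATA: the two top partial canonical densities coincide on the window.**  For `γ ≥ 0`, `J ≤ K`, and the window `{PlaqSmall θ_J}` inside `regSet` of
`heightDensity^{histGood K J}` (WREG's (R)), the canonical densities of «depths `< K − J` small» and «depths `< K − J + 1` small» agree at every window point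
(the first event is `histGood K (J+1)`, the second `histGood K J`). [cite: Balaban1985UV3, (7) p.257; Balaban1987RG1, (0.13) p.254] -/
theorem heightDensityCan_depthBelow_top_eq (γ b₀ p₀ : ℝ) (hγ : 0 ≤ γ) {J K : ℕ} (hJK : J ≤ K)
    (hreg : {V : GaugeField (F.P J) 0 (Matrix.specialUnitaryGroup (Fin 2) ℂ) | PlaqSmall (θBal F.L γ b₀ p₀ J) V} ⊆
      Node00.regSet (fieldMeasure (F.P J) 0 (Matrix.specialUnitaryGroup (Fin 2) ℂ))
        (heightDensity F γ hJK (histGood F ℰp (θBal F.L γ b₀ p₀) K J)))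
    (U : GaugeField (F.P J) 0 (Matrix.specialUnitaryGroup (Fin 2) ℂ)) (hU : PlaqSmall (θBal F.L γ b₀ p₀ J) U) :
    heightDensityCan F γ hJK
        {U' : GaugeField (F.P K) 0 (Matrix.specialUnitaryGroup (Fin 2) ℂ) | ∀ j, j + J ≤ K → j < K - J →
          PlaqSmall (θBal F.L γ b₀ p₀ (K - j)) (Averaging.iter (fun i => BlockAveraging.blockAvg (P := F.P K) (j := i) ℰp) j U')} U =
      heightDensityCan F γ hJK
        {U' : GaugeField (F.P K) 0 (Matrix.specialUnitaryGroup (Fin 2) ℂ) | ∀ j, j + J ≤ K → j < K - J + 1 →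
          PlaqSmall (θBal F.L γ b₀ p₀ (K - j)) (Averaging.iter (fun i => BlockAveraging.blockAvg (P := F.P K) (j := i) ℰp) j U')} U := by
  have htop := setOf_depthBelow_eq_histGood F (θBal F.L γ b₀ p₀) (J := J) (K := K) (M := K - J) hJK (by omega)
  rw [show K + 1 - (K - J) = J + 1 by omega] at htop
  rw [htop, setOf_depthBelow_eq_histGood_of_lt F (θBal F.L γ b₀ p₀) (J := J) (K := K) (M := K - J + 1) (by omega)]
  exact (heightDensityCan_succ_eq_on_window F hγ hJK (θBal F.L γ b₀ p₀) hreg).2 U hU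

/-- ★ **THE TOP INCREMENT OF THE ODDS LEDGER VANISHES ON THE WINDOW**: below WREG's threshold `γ₁ = γ₁^{WREG}(L, b₀, p₀)`, for every run `K`, height `J ≤ K`
and window point `U`, `ℓ_{K−J}(U) = log q_{K−J}(U) − log q_{K−J+1}(U) = 0` (the line's `oddsInc … (K − J) U`, written out). [cite: Balaban1985UV3, (7) p.257 and (38) p.266] -/
theorem oddsInc_top_eq_zero_on_window :
    ∀ (L : ℕ) (b₀ p₀ : ℝ), 0 < b₀ → 0 < p₀ → ∃ γ₁ : ℝ, 0 < γ₁ ∧ ∀ (F : T3Family) (γ : ℝ), F.L = L → 0 < γ → γ ≤ γ₁ →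
      ∀ (J K : ℕ) (hJK : J ≤ K) (U : GaugeField (F.P J) 0 (Matrix.specialUnitaryGroup (Fin 2) ℂ)), PlaqSmall (θBal F.L γ b₀ p₀ J) U →
        Real.log (heightDensityCan F γ hJK
            {U' : GaugeField (F.P K) 0 (Matrix.specialUnitaryGroup (Fin 2) ℂ) | ∀ j, j + J ≤ K → j < K - J →
              PlaqSmall (θBal F.L γ b₀ p₀ (K - j)) (Averaging.iter (fun i => BlockAveraging.blockAvg (P := F.P K) (j := i) ℰp) j U')} U) -
          Real.log (heightDensityCan F γ hJK
            {U' : GaugeField (F.P K) 0 (Matrix.specialUnitaryGroup (Fin 2) ℂ) | ∀ j, j + J ≤ K → j < K - J + 1 →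
              PlaqSmall (θBal F.L γ b₀ p₀ (K - j)) (Averaging.iter (fun i => BlockAveraging.blockAvg (P := F.P K) (j := i) ℰp) j U')} U) = 0 := by
  intro L b₀ p₀ hb₀ hp₀
  obtain ⟨γ₁, hγ₁, hWREG⟩ := windowRegularity L b₀ p₀ hb₀ hp₀
  refine ⟨γ₁, hγ₁, fun F γ hL hγ hγle J K hJK U hU => ?_⟩
  obtain ⟨hreg, -⟩ := hWREG F γ hL hγ hγle J K hJK γ hγ
  rw [heightDensityCan_depthBelow_top_eq F γ b₀ p₀ hγ.le hJK hreg U hU, sub_self]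

/-- **A FUNCTION VANISHING ON A SET HAS VANISHING MIXED SECOND DIFFERENCES THERE** (the line's `fourPt f U V W Z := (f U − f V) − (f W − f Z)`, written out):
with `oddsInc_top_eq_zero_on_window` this is LEV's displayed row at the depth `M = K − J` with the budget `w J 0 := 0` (any rate `κ`, no one-bond relation
between the four window fields needed). [cite: Balaban1985UV3, (38)-(41) p.266] -/
theorem abs_fourPt_le_of_eqOn_zero {X : Type*} (f : X → ℝ) (S : Set X) (hf : ∀ x ∈ S, f x = 0) {U V W Z : X}
    (hU : U ∈ S) (hV : V ∈ S) (hW : W ∈ S) (hZ : Z ∈ S) {w e : ℝ} (hw : 0 ≤ w) (he : 0 ≤ e) :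
    (f U - f V) - (f W - f Z) = 0 ∧ |(f U - f V) - (f W - f Z)| ≤ w * e := by
  rw [hf U hU, hf V hV, hf W hW, hf Z hZ]
  norm_num
  exact mul_nonneg hw he

/-- ★ **LEV's ROW AT THE TOP DEPTH, BY KERNEL**: below WREG's threshold, for every run `K`, height `J ≤ K`, rate `κ`, budget value `w ≥ 0` and window quadruple,
`|Δ² ℓ_{K−J}(U,V,W,Z)| ≤ w · e^{−κ·tdist(b,b′)}` — in fact the left side is `0`. [cite: Balaban1985UV3, (38)-(41) p.266] -/
theorem abs_fourPt_oddsInc_top_le :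
    ∀ (L : ℕ) (b₀ p₀ : ℝ), 0 < b₀ → 0 < p₀ → ∃ γ₁ : ℝ, 0 < γ₁ ∧ ∀ (F : T3Family) (γ : ℝ), F.L = L → 0 < γ → γ ≤ γ₁ →
      ∀ (J K : ℕ) (hJK : J ≤ K) (κ w : ℝ), 0 ≤ w → ∀ (b b' : PBond (F.P J) 0) (U V W Z : GaugeField (F.P J) 0 (Matrix.specialUnitaryGroup (Fin 2) ℂ)),
        PlaqSmall (θBal F.L γ b₀ p₀ J) U → PlaqSmall (θBal F.L γ b₀ p₀ J) V →
        PlaqSmall (θBal F.L γ b₀ p₀ J) W → PlaqSmall (θBal F.L γ b₀ p₀ J) Z →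
        letI ℓ : GaugeField (F.P J) 0 (Matrix.specialUnitaryGroup (Fin 2) ℂ) → ℝ := fun X =>
          Real.log (heightDensityCan F γ hJK
            {U' : GaugeField (F.P K) 0 (Matrix.specialUnitaryGroup (Fin 2) ℂ) | ∀ j, j + J ≤ K → j < K - J →
              PlaqSmall (θBal F.L γ b₀ p₀ (K - j)) (Averaging.iter (fun i => BlockAveraging.blockAvg (P := F.P K) (j := i) ℰp) j U')} X) -
          Real.log (heightDensityCan F γ hJK
            {U' : GaugeField (F.P K) 0 (Matrix.specialUnitaryGroup (Fin 2) ℂ) | ∀ j, j + J ≤ K → j < K - J + 1 →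
              PlaqSmall (θBal F.L γ b₀ p₀ (K - j)) (Averaging.iter (fun i => BlockAveraging.blockAvg (P := F.P K) (j := i) ℰp) j U')} X)
        |(ℓ U - ℓ V) - (ℓ W - ℓ Z)| ≤ w * Real.exp (-(κ * (b.src.tdist b'.src : ℝ))) := by
  intro L b₀ p₀ hb₀ hp₀
  obtain ⟨γ₁, hγ₁, h⟩ := oddsInc_top_eq_zero_on_window L b₀ p₀ hb₀ hp₀
  refine ⟨γ₁, hγ₁, fun F γ hL hγ hγle J K hJK κ w hw b b' U V W Z hU hV hW hZ => ?_⟩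
  exact (abs_fourPt_le_of_eqOn_zero _ {X | PlaqSmall (θBal F.L γ b₀ p₀ J) X} (fun X hX => h F γ hL hγ hγle J K hJK X hX)
    hU hV hW hZ hw (Real.exp_pos _).le).2

/-! ## §2 LEV ⟸ LEV BELOW THE TOP DEPTH (a door: the row restricted to `M + J < K` gives the registered row) -/

/-- ★★ **THE DOOR «LEV ⟸ LEV AT THE DEPTHS `M < K − J`»**: if LEV's registered text (`Lines/odds_ledger.lean` v1.2 `LevelOddsLedgerCan`, written out) holds with
the depth guard `M + J ≤ K` STRENGTHENED to `M + J < K` (only the depths with at least one cutoff-free transport), then it holds as registered — the missing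
depth `M = K − J` is `oddsInc_top_eq_zero_on_window` (budget value `w J 0 ≥ 0`, any rate).  Thresholds: `pS` unchanged, `γ₁ := min γ₁ γ₁^{WREG}`, `κ, w, ψ`
unchanged.  On the first rung `K = J + 1` the hypothesis has the single depth `M = 0`. [cite: Balaban1985UV3, (38)-(47) p.266-267] -/
theorem levelOddsLedger_of_below
    (h : ∀ (L : ℕ), ∃ pS : ℝ, ∀ (b₀ p₀ : ℝ), 0 < b₀ → pS ≤ p₀ → 0 < p₀ →
      ∃ γ₁ : ℝ, 0 < γ₁ ∧ ∃ κ : ℝ, 0 < κ ∧ ∀ (F : T3Family) (γ : ℝ), F.L = L → 0 < γ → γ ≤ γ₁ →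
        ∃ w : ℕ → ℕ → ℝ, (∀ J r, 0 ≤ w J r) ∧
          ∃ ψ : ℕ → ℝ, (∀ J, 0 ≤ ψ J) ∧ Tendsto (fun J : ℕ => (J : ℝ) * ψ J) atTop (𝓝 0) ∧
            (∀ J R, ∑ r ∈ Finset.range R, w J r ≤ ψ J) ∧
            ∀ (J K : ℕ) (hJK : J ≤ K),
              (∀ (M : ℕ) (U : GaugeField (F.P J) 0 (Matrix.specialUnitaryGroup (Fin 2) ℂ)), PlaqSmall (θBal F.L γ b₀ p₀ J) U →
                  0 < heightDensityCan F γ hJK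
                    {U' : GaugeField (F.P K) 0 (Matrix.specialUnitaryGroup (Fin 2) ℂ) | ∀ j, j + J ≤ K → j < M →
                      PlaqSmall (θBal F.L γ b₀ p₀ (K - j)) (Averaging.iter (fun i => BlockAveraging.blockAvg (P := F.P K) (j := i) ℰp) j U')} U) →
              ∀ (M : ℕ), M + J < K →
                ∀ (b b' : PBond (F.P J) 0) (U V W Z : GaugeField (F.P J) 0 (Matrix.specialUnitaryGroup (Fin 2) ℂ)),
                  PlaqSmall (θBal F.L γ b₀ p₀ J) U → PlaqSmall (θBal F.L γ b₀ p₀ J) V →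
                  PlaqSmall (θBal F.L γ b₀ p₀ J) W → PlaqSmall (θBal F.L γ b₀ p₀ J) Z →
                  (∀ e, e ≠ b → U e = V e) → (∀ e, e ≠ b' → U e = W e) → (∀ e, e ≠ b' → V e = Z e) → (∀ e, e ≠ b → W e = Z e) →
                  letI ℓ : GaugeField (F.P J) 0 (Matrix.specialUnitaryGroup (Fin 2) ℂ) → ℝ := fun X =>
                    Real.log (heightDensityCan F γ hJK
                      {U' : GaugeField (F.P K) 0 (Matrix.specialUnitaryGroup (Fin 2) ℂ) | ∀ j, j + J ≤ K → j < M →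
                        PlaqSmall (θBal F.L γ b₀ p₀ (K - j)) (Averaging.iter (fun i => BlockAveraging.blockAvg (P := F.P K) (j := i) ℰp) j U')} X) -
                    Real.log (heightDensityCan F γ hJK
                      {U' : GaugeField (F.P K) 0 (Matrix.specialUnitaryGroup (Fin 2) ℂ) | ∀ j, j + J ≤ K → j < M + 1 →
                        PlaqSmall (θBal F.L γ b₀ p₀ (K - j)) (Averaging.iter (fun i => BlockAveraging.blockAvg (P := F.P K) (j := i) ℰp) j U')} X)
                  |(ℓ U - ℓ V) - (ℓ W - ℓ Z)| ≤ w J (K - J - M) * Real.exp (-(κ * (b.src.tdist b'.src : ℝ)))) :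
    ∀ (L : ℕ), ∃ pS : ℝ, ∀ (b₀ p₀ : ℝ), 0 < b₀ → pS ≤ p₀ → 0 < p₀ →
      ∃ γ₁ : ℝ, 0 < γ₁ ∧ ∃ κ : ℝ, 0 < κ ∧ ∀ (F : T3Family) (γ : ℝ), F.L = L → 0 < γ → γ ≤ γ₁ →
        ∃ w : ℕ → ℕ → ℝ, (∀ J r, 0 ≤ w J r) ∧
          ∃ ψ : ℕ → ℝ, (∀ J, 0 ≤ ψ J) ∧ Tendsto (fun J : ℕ => (J : ℝ) * ψ J) atTop (𝓝 0) ∧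
            (∀ J R, ∑ r ∈ Finset.range R, w J r ≤ ψ J) ∧
            ∀ (J K : ℕ) (hJK : J ≤ K),
              (∀ (M : ℕ) (U : GaugeField (F.P J) 0 (Matrix.specialUnitaryGroup (Fin 2) ℂ)), PlaqSmall (θBal F.L γ b₀ p₀ J) U →
                  0 < heightDensityCan F γ hJK
                    {U' : GaugeField (F.P K) 0 (Matrix.specialUnitaryGroup (Fin 2) ℂ) | ∀ j, j + J ≤ K → j < M →
                      PlaqSmall (θBal F.L γ b₀ p₀ (K - j)) (Averaging.iter (fun i => BlockAveraging.blockAvg (P := F.P K) (j := i) ℰp) j U')} U) →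
              ∀ (M : ℕ), M + J ≤ K →
                ∀ (b b' : PBond (F.P J) 0) (U V W Z : GaugeField (F.P J) 0 (Matrix.specialUnitaryGroup (Fin 2) ℂ)),
                  PlaqSmall (θBal F.L γ b₀ p₀ J) U → PlaqSmall (θBal F.L γ b₀ p₀ J) V →
                  PlaqSmall (θBal F.L γ b₀ p₀ J) W → PlaqSmall (θBal F.L γ b₀ p₀ J) Z →
                  (∀ e, e ≠ b → U e = V e) → (∀ e, e ≠ b' → U e = W e) → (∀ e, e ≠ b' → V e = Z e) → (∀ e, e ≠ b → W e = Z e) →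
                  letI ℓ : GaugeField (F.P J) 0 (Matrix.specialUnitaryGroup (Fin 2) ℂ) → ℝ := fun X =>
                    Real.log (heightDensityCan F γ hJK
                      {U' : GaugeField (F.P K) 0 (Matrix.specialUnitaryGroup (Fin 2) ℂ) | ∀ j, j + J ≤ K → j < M →
                        PlaqSmall (θBal F.L γ b₀ p₀ (K - j)) (Averaging.iter (fun i => BlockAveraging.blockAvg (P := F.P K) (j := i) ℰp) j U')} X) -
                    Real.log (heightDensityCan F γ hJK
                      {U' : GaugeField (F.P K) 0 (Matrix.specialUnitaryGroup (Fin 2) ℂ) | ∀ j, j + J ≤ K → j < M + 1 →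
                        PlaqSmall (θBal F.L γ b₀ p₀ (K - j)) (Averaging.iter (fun i => BlockAveraging.blockAvg (P := F.P K) (j := i) ℰp) j U')} X)
                  |(ℓ U - ℓ V) - (ℓ W - ℓ Z)| ≤ w J (K - J - M) * Real.exp (-(κ * (b.src.tdist b'.src : ℝ))) := by
  intro L
  obtain ⟨pS, hS⟩ := h L
  refine ⟨pS, fun b₀ p₀ hb₀ hpS hp₀ => ?_⟩
  obtain ⟨γB, hγB, κ, hκ, hB⟩ := hS b₀ p₀ hb₀ hpS hp₀
  obtain ⟨γT, hγT, hT⟩ := oddsInc_top_eq_zero_on_window L b₀ p₀ hb₀ hp₀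
  refine ⟨min γB γT, lt_min hγB hγT, κ, hκ, fun F γ hL hγ hγle => ?_⟩
  obtain ⟨w, hw, ψ, hψ, hψ0, hwψ, hrow⟩ := hB F γ hL hγ (hγle.trans (min_le_left _ _))
  refine ⟨w, hw, ψ, hψ, hψ0, hwψ, fun J K hJK hpos M hM b b' U V W Z hU hV hW hZ h1 h2 h3 h4 => ?_⟩
  rcases Nat.lt_or_ge (M + J) K with hlt | hge
  · exact hrow J K hJK hpos M hlt b b' U V W Z hU hV hW hZ h1 h2 h3 h4
  · have hMeq : M = K - J := by omega
    subst hMeq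
    rw [show K - J - (K - J) = 0 by omega]
    exact (abs_fourPt_le_of_eqOn_zero _ {X | PlaqSmall (θBal F.L γ b₀ p₀ J) X}
      (fun X hX => hT F γ hL hγ (hγle.trans (min_le_right _ _)) J K hJK X hX) hU hV hW hZ (hw J 0) (Real.exp_pos _).le).2

end Summit.QuantumFields.YangMills.Theorems.FluctuationComparisonRegPrIntLOddsLedgerTopIncrement

end
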